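import Mathlib
import Summits.ValiantsHypothesis.ValiantsHypothesis.Theses.BarrierLever
import Summits.ValiantsHypothesis.ValiantsHypothesis.Theorems.BarrierLeverDefinableEquationsDefs
import Summits.ValiantsHypothesis.ValiantsHypothesis.Theorems.BarrierLeverDefinableEquationsSuccinctContraction
import Summits.ValiantsHypothesis.ValiantsHypothesis.Theorems.BarrierLeverDefinableEquationsTopEquations
import Summits.ValiantsHypothesis.ValiantsHypothesis.Theorems.BarrierLeverDefinableEquationsRazAnnihilators

/-!
# Crux `BarrierLever.DefinableEquations` (stmt-8745) / item `SingleSizeEquations` (stmt-8749) —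
# the crux and the item FROM SUCCINCT CONTRACTION EQUATIONS (val-np-p5 g7; crux-level glue over
# the route-independent `…DefinableEquationsSuccinctContraction.lean`)

With `F_Q = ∑_{i : Fin D × Fin n → Fin n} ∑_{w : Fin r → Bool} Q(X; oneHot i, w) · ∏_k X_{e(i|k)}`
the succinct contraction sum of a polynomial `Q` on the top coefficient variables and the Boolean
block `BPos D n ⊕ Fin r` (`SuccinctContraction.exists_witness`: `F_Q` is a Boolean sum of size
`L(Q) + (D+n+3)^6 · C(2n,n)`), "a succinct contraction equation at scale `N^c` for `(n, b)`" means: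
`D, r, L(Q), deg Q ≤ N^c`, `F_Q ≠ 0`, and `F_Q` vanishes at the top homogeneous component of
every `f ∈ SmallCircuits ℂ n b` (or, in the Raz form, on the whole image `razPoint n b` of the
universal-circuit map).

* `SuccinctContraction.eq_of_succinct` — such an equation gives the crux's inner statement
  `Eq(n, b, 6c+14)` (`n ≥ 2`; via `TopEquations.eq_of_topEq`).
* `definableEquations_of_succinctContractionEquation` — ONE scale `c` serving every `b`
  (eventually in `n`) ⇒ `DefinableEquations`, level `6c + 14`.
* `definableEquations_of_succinctRazEquation` — the same from succinct annihilators of Raz's map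
  (via `RazAnnihilators.definableEquations_of`): Chatterjee–Tengse's direction 2 asks for exactly
  such `#P`-explicit annihilators of one explicit polynomial map.
* `singleSizeEquations_of_succinctContractionEquation` — a scale `c(b)` per `b` ⇒ item 8749.

These extend `DefinableEquations_of_polyShortTableauEquation` /
`razAnnihilators_of_polyShortTableauEquation` from poly-SHORT lists of tableau contractions to
succinct sums of EXPONENTIAL length (`n^{Dn} · 2^r` terms) whose coefficients are Boolean-cube sums
of the values of one poly(`N`)-size polynomial — the route's foreseen arrow
`TableauCoordinatesSharpP → ValiantCriterionAtScaleN → crux` with the tableau layer abstracted into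
`Q`.  Honest scope: `Q` may involve the coefficient variables `X`, so at `D = 0` the hypothesis
is `TopEq` itself (`F_Q = boolSum Q`); the content is the case where the monomial AND its
coefficient are described on bits (`X`-free `Q`, `D ≥ 1`) — the `#P`-explicit form.  Reductions
only (the gate records them as conditional): the crux stays OPEN (Chatterjee–Tengse 2023 §1.3
direction 2) and nothing here bears on `VP ≠ VNP`.  No definitions, no named facts.
Refs: P. Bürgisser, *Completeness and Reduction in Algebraic Complexity Theory* (2000), Prop. 2.20;
P. Chatterjee, A. Tengse, arXiv:2309.07612 §1.3.
-/

set_option linter.dupNamespace false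

noncomputable section

namespace Summit.ValiantsHypothesis.ValiantsHypothesis.Theorems.BarrierLeverDefinableEquations

open MvPolynomial Literature.Computability.AlgebraicComplexity
open Literature.Barriers.ValiantsHypothesis
open scoped BigOperators

namespace SuccinctContraction

/-- **Succinct top equation ⇒ `Eq(n, b, 6c+14)`** (`n ≥ 2`), the crux's inner statement at `n`
(via `TopEquations.eq_of_topEq`). [cite: Burgisser2000, Prop. 2.20] -/
theorem eq_of_succinct {c b n : ℕ} (hn : 2 ≤ n)
    (h : ∃ D r : ℕ, D ≤ (Nat.choose (2 * n) n) ^ c ∧ r ≤ (Nat.choose (2 * n) n) ^ c ∧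
      ∃ Q : MvPolynomial (↥(topMonomials n) ⊕ (BPos D n ⊕ Fin r)) ℂ,
        complexity Q ≤ (Nat.choose (2 * n) n) ^ c ∧
        Q.totalDegree ≤ (Nat.choose (2 * n) n) ^ c ∧
        (∑ i : Fin D × Fin n → Fin n, ∑ w : Fin r → Bool,
            aeval (boolPt (Sum.elim (oneHot i) w)) Q * ∏ k : Fin D, X (expTop fun l => i (k, l)))
          ≠ 0 ∧
        ∀ f ∈ SmallCircuits ℂ n b,
          eval (fun e : topMonomials n => coeff (e : Fin n →₀ ℕ) f)
            (∑ i : Fin D × Fin n → Fin n, ∑ w : Fin r → Bool,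
              aeval (boolPt (Sum.elim (oneHot i) w)) Q *
                ∏ k : Fin D, X (expTop fun l => i (k, l))) = 0) :
    ∃ q : ℕ, q ≤ (Nat.choose (2 * n) n) ^ (6 * c + 14) ∧
      ∃ H : MvPolynomial (↥(degLEMonomials n) ⊕ Fin q) ℂ,
        complexity H ≤ (Nat.choose (2 * n) n) ^ (6 * c + 14) ∧
        H.totalDegree ≤ (Nat.choose (2 * n) n) ^ (6 * c + 14) ∧
        boolSum H ≠ 0 ∧
        ∀ f ∈ SmallCircuits ℂ n b, eval (coeffVector (degLEMonomials n) f) (boolSum H) = 0 :=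
  TopEquations.eq_of_topEq (topEq_of_succinct hn h)

end SuccinctContraction


open SuccinctContraction

/-- **The crux from ONE scale of succinct contraction equations.**  If for some `c`, for every
size exponent `b`, eventually in `n`, some polynomial `Q` with `D, r, L(Q), deg Q ≤ N^c` has a
NONZERO succinct contraction sum `∑_i ∑_w Q(X; oneHot i, w) ∏_k X_{e(i|k)}` vanishing at the
top component of every `f ∈ SmallCircuits ℂ n b`, then `DefinableEquations` holds (level `6c + 14`).
Extends `DefinableEquations_of_polyShortTableauEquation` from poly-short lists to succinct sums of
exponential length. [cite: Burgisser2000, Prop. 2.20] -/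
theorem definableEquations_of_succinctContractionEquation
    (h : ∃ c : ℕ, ∀ b : ℕ, ∃ n₀ : ℕ, ∀ n ≥ n₀,
      ∃ D r : ℕ, D ≤ (Nat.choose (2 * n) n) ^ c ∧ r ≤ (Nat.choose (2 * n) n) ^ c ∧
      ∃ Q : MvPolynomial (↥(topMonomials n) ⊕ (BPos D n ⊕ Fin r)) ℂ,
        complexity Q ≤ (Nat.choose (2 * n) n) ^ c ∧
        Q.totalDegree ≤ (Nat.choose (2 * n) n) ^ c ∧
        (∑ i : Fin D × Fin n → Fin n, ∑ w : Fin r → Bool,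
            aeval (boolPt (Sum.elim (oneHot i) w)) Q * ∏ k : Fin D, X (expTop fun l => i (k, l)))
          ≠ 0 ∧
        ∀ f ∈ SmallCircuits ℂ n b,
          eval (fun e : topMonomials n => coeff (e : Fin n →₀ ℕ) f)
            (∑ i : Fin D × Fin n → Fin n, ∑ w : Fin r → Bool,
              aeval (boolPt (Sum.elim (oneHot i) w)) Q *
                ∏ k : Fin D, X (expTop fun l => i (k, l))) = 0) :
    Summit.ValiantsHypothesis.ValiantsHypothesis.Theses.BarrierLever.DefinableEquations := by
  obtain ⟨c, hc⟩ := h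
  refine ⟨6 * c + 14, fun b => ?_⟩
  obtain ⟨n₀, hn₀⟩ := hc b
  refine ⟨max n₀ 2, fun n hn => ?_⟩
  exact eq_of_succinct (le_trans (le_max_right _ _) hn) (hn₀ n (le_trans (le_max_left _ _) hn))

/-- **The crux from ONE scale of succinct annihilators of Raz's map** (vanishing on the image
`razPoint n b` of the universal-circuit map in place of `SmallCircuits`; via
`RazAnnihilators.definableEquations_of`). [cite: Burgisser2000, Prop. 2.20] -/
theorem definableEquations_of_succinctRazEquation
    (h : ∃ c : ℕ, ∀ b : ℕ, ∃ n₀ : ℕ, ∀ n ≥ n₀,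
      ∃ D r : ℕ, D ≤ (Nat.choose (2 * n) n) ^ c ∧ r ≤ (Nat.choose (2 * n) n) ^ c ∧
      ∃ Q : MvPolynomial (↥(topMonomials n) ⊕ (BPos D n ⊕ Fin r)) ℂ,
        complexity Q ≤ (Nat.choose (2 * n) n) ^ c ∧
        Q.totalDegree ≤ (Nat.choose (2 * n) n) ^ c ∧
        (∑ i : Fin D × Fin n → Fin n, ∑ w : Fin r → Bool,
            aeval (boolPt (Sum.elim (oneHot i) w)) Q * ∏ k : Fin D, X (expTop fun l => i (k, l)))
          ≠ 0 ∧
        ∀ y : RazUniversal.Lab (Fin n) n (razSlots n b) → ℂ,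
          eval (razPoint n b y)
            (∑ i : Fin D × Fin n → Fin n, ∑ w : Fin r → Bool,
              aeval (boolPt (Sum.elim (oneHot i) w)) Q *
                ∏ k : Fin D, X (expTop fun l => i (k, l))) = 0) :
    Summit.ValiantsHypothesis.ValiantsHypothesis.Theses.BarrierLever.DefinableEquations := by
  obtain ⟨c, hc⟩ := h
  refine RazAnnihilators.definableEquations_of ⟨6 * c + 14, fun b => ?_⟩
  obtain ⟨n₀, hn₀⟩ := hc b
  refine ⟨max n₀ 2, fun n hn => ?_⟩
  exact razAnn_of_succinct (le_trans (le_max_right _ _) hn) (hn₀ n (le_trans (le_max_left _ _) hn))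

/-- **Item `SingleSizeEquations` from succinct contraction equations, one scale per size
exponent** (`c` may depend on `b`; level `6c + 14`). [cite: Burgisser2000, Prop. 2.20] -/
theorem singleSizeEquations_of_succinctContractionEquation
    (h : ∀ b : ℕ, ∃ c n₀ : ℕ, ∀ n ≥ n₀,
      ∃ D r : ℕ, D ≤ (Nat.choose (2 * n) n) ^ c ∧ r ≤ (Nat.choose (2 * n) n) ^ c ∧
      ∃ Q : MvPolynomial (↥(topMonomials n) ⊕ (BPos D n ⊕ Fin r)) ℂ,
        complexity Q ≤ (Nat.choose (2 * n) n) ^ c ∧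
        Q.totalDegree ≤ (Nat.choose (2 * n) n) ^ c ∧
        (∑ i : Fin D × Fin n → Fin n, ∑ w : Fin r → Bool,
            aeval (boolPt (Sum.elim (oneHot i) w)) Q * ∏ k : Fin D, X (expTop fun l => i (k, l)))
          ≠ 0 ∧
        ∀ f ∈ SmallCircuits ℂ n b,
          eval (fun e : topMonomials n => coeff (e : Fin n →₀ ℕ) f)
            (∑ i : Fin D × Fin n → Fin n, ∑ w : Fin r → Bool,
              aeval (boolPt (Sum.elim (oneHot i) w)) Q *
                ∏ k : Fin D, X (expTop fun l => i (k, l))) = 0) :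
    Summit.ValiantsHypothesis.ValiantsHypothesis.Theses.BarrierLever.SingleSizeEquations := by
  intro b
  obtain ⟨c, n₀, hn₀⟩ := h b
  refine ⟨6 * c + 14, max n₀ 2, fun n hn => ?_⟩
  exact eq_of_succinct (le_trans (le_max_right _ _) hn) (hn₀ n (le_trans (le_max_left _ _) hn))

end Summit.ValiantsHypothesis.ValiantsHypothesis.Theorems.BarrierLeverDefinableEquations

end
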